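import Summits.Ventures.PercRepro.C041CutGlueBound

/-!
# LEMMA O₂, the unique-gate case, as an instance of LEMMA G (p6, gen 25; C-041.md §7 (4), §9)

mine-3's LEMMA O₂ (§7) is the 2-vertex opening `Ψ = F(O) + F(O + e) ≥ 0` for a pendant zone `P = {u′, u″}`
(`e = u′u″` blue in `O`, `u″ ∈ K` without terminal edges, `u′ ∉ K` with one 1-edge and one 2-edge, or a single
1-edge).  In its case (4) — `P` the unique gate — the paper tabulates the six sub-states of the gadget in front of
`u″` (the layer × the colouring of `u′`'s edges) against the three bits `(V″, G₁″, G₂″)` of the sub-problem `Γ″`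
beyond `u″` and sums: `Ψ = 4Φ″ + 2·#{x′ : V″}` for the type-`{1, 2}` pendant, `Ψ = 3Φ″ + #{x′}` for the pure
type-`1` pendant.  §9 notes that these computations are the shape of LEMMA G.

This file makes that literal: the gadget is the `CutGlue.Space` on `Fin 6` (resp. `Fin 4`) with the bits of the
paper's table — `blueRR, blueBR, blueRB, redRR, redBR, redRB` = `0 … 5`: the blue layer is never valid and never
Good (`u′ ∉ K`), its state `t` deletes `u″` on side `t` (`ρ_t = 0` exactly at `blueBR` / `blueRB`); in the red layer
`u′` is a reached singleton port: `redRR` is Good on both sides, `redBR` / `redRB` are valid with one side deleted and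
the other useless — and the glue identity `phi_glue` evaluates to the paper's two formulas (`o2_full`, `o2_pure`),
hence `Ψ ≥ 0` whenever `Φ″ ≥ 0` (`o2_full_nonneg`, `o2_pure_nonneg`; `Φ″ ≥ 0` is THE LEMMA of §3 on `Γ″`, a
`ZonePort` theorem not re-derived here).  NOT claimed: the identification of the skeleton's pendant-zone sub-states
with these six bits (the paper's reading of the gadget); cases (1)–(3) and (5) of §7.
-/

namespace PercRepro

namespace CutGlue

open Finset

/-- The gadget of the type-`{1, 2}` pendant zone at the unique gate: states `0 … 5` = `blueRR, blueBR, blueRB, redRR,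
redBR, redRB`, all of weight `1`; `Good₁ = Good₂ = [redRR]`; valid = red layer. -/
def o2Gadget : Space (Fin 6) where
  w _ := 1
  G₁ σ := σ = 3
  G₂ σ := σ = 3
  V σ := σ = 3 ∨ σ = 4 ∨ σ = 5
  hG₁ _ h := Or.inl h
  hG₂ _ h := Or.inl h

/-- `ρ₁` of the type-`{1, 2}` pendant: `u″` is deleted on side `1` exactly in the blue state `BR`. -/
def o2Rho₁ (σ : Fin 6) : Prop := σ ≠ 1

/-- `ρ₂` of the type-`{1, 2}` pendant: `u″` is deleted on side `2` exactly in the blue state `RB`. -/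
def o2Rho₂ (σ : Fin 6) : Prop := σ ≠ 2

/-- `Φ(gadget) = 0` (`4 − 2 − 2`). -/
theorem o2Gadget_phi : o2Gadget.phi = 0 := by
  unfold Space.phi Space.wt o2Gadget
  rw [Fin.sum_univ_six]
  simp [ind]

/-- `Φ_all(gadget) = −6`. -/
theorem o2Gadget_phiAll : o2Gadget.phiAll = -6 := by
  unfold Space.phiAll Space.wt o2Gadget
  rw [Fin.sum_univ_six]
  simp [ind]

/-- `m₁(gadget) = 4`: `blueRR, blueRB, redBR, redRB`. -/
theorem o2Gadget_m₁ : o2Gadget.m₁ o2Rho₁ = 4 := by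
  unfold Space.m₁ Space.cnt o2Gadget o2Rho₁
  rw [Fin.sum_univ_six]
  simp

/-- `m₂(gadget) = 4`: `blueRR, blueBR, redBR, redRB`. -/
theorem o2Gadget_m₂ : o2Gadget.m₂ o2Rho₂ = 4 := by
  unfold Space.m₂ Space.cnt o2Gadget o2Rho₂
  rw [Fin.sum_univ_six]
  simp

variable {X : Type*} [Fintype X]

open Classical in
/-- **LEMMA O₂ (4), type `{1, 2}`** (C-041.md §7 (4)): `Ψ = 4Φ″ + 2·#{x′ : V″}`. -/
theorem o2_full (Q : Space X) : (glue o2Gadget o2Rho₁ o2Rho₂ Q).phi = 4 * Q.phi + 2 * Q.NV := by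
  rw [phi_glue, o2Gadget_phi, o2Gadget_phiAll, o2Gadget_m₁, o2Gadget_m₂]
  unfold Space.phi Space.NV Space.cnt Space.wt
  rw [Finset.mul_sum, Finset.mul_sum, ← Finset.sum_add_distrib]
  simp only [zero_mul, zero_add]
  apply Finset.sum_congr rfl
  intro x _
  by_cases hx : Q.V x
  · simp only [if_pos hx]
    ring
  · simp only [if_neg hx]
    ring

/-- **LEMMA O₂ (4), type `{1, 2}`, the inequality**: `Ψ ≥ 0` whenever `Φ″ ≥ 0`. -/
theorem o2_full_nonneg (Q : Space X) (hQ : 0 ≤ Q.phi) : 0 ≤ (glue o2Gadget o2Rho₁ o2Rho₂ Q).phi := by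
  rw [o2_full]
  have := Q.NV_nonneg
  linarith

/-- The gadget of the pure type-`1` pendant zone at the unique gate: states `0 … 3` = `blueR, blueB, redR, redB`;
`Good₂ = [redR]` (the red 1-edge at the reached `u′`), `Good₁ = 0`; valid = `redR` only. -/
def o2pGadget : Space (Fin 4) where
  w _ := 1
  G₁ _ := False
  G₂ σ := σ = 2
  V σ := σ = 2
  hG₁ _ h := h.elim
  hG₂ _ h := h

/-- `ρ₁` of the pure type-`1` pendant: `u″` is deleted on side `1` exactly in the blue state `B`. -/
def o2pRho₁ (σ : Fin 4) : Prop := σ ≠ 1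

/-- `ρ₂` of the pure type-`1` pendant: `u″` is never deleted on side `2`. -/
def o2pRho₂ (_ : Fin 4) : Prop := True

/-- `Φ(gadget) = 1`. -/
theorem o2pGadget_phi : o2pGadget.phi = 1 := by
  unfold Space.phi Space.wt o2pGadget
  rw [Fin.sum_univ_four]
  simp [ind]

/-- `Φ_all(gadget) = −5`. -/
theorem o2pGadget_phiAll : o2pGadget.phiAll = -5 := by
  unfold Space.phiAll Space.wt o2pGadget
  rw [Fin.sum_univ_four]
  simp [ind]

/-- `m₁(gadget) = 3`: `blueR, redR, redB`. -/
theorem o2pGadget_m₁ : o2pGadget.m₁ o2pRho₁ = 3 := by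
  unfold Space.m₁ Space.cnt o2pGadget o2pRho₁
  rw [Fin.sum_univ_four]
  simp

/-- `m₂(gadget) = 3`: `blueR, blueB, redB`. -/
theorem o2pGadget_m₂ : o2pGadget.m₂ o2pRho₂ = 3 := by
  unfold Space.m₂ Space.cnt o2pGadget o2pRho₂
  rw [Fin.sum_univ_four]
  simp

open Classical in
/-- **LEMMA O₂ (4), pure type `1`** (C-041.md §7 (4)): `Ψ = 3Φ″ + #{x′}`. -/
theorem o2_pure (Q : Space X) : (glue o2pGadget o2pRho₁ o2pRho₂ Q).phi = 3 * Q.phi + Q.N := by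
  rw [phi_glue, o2pGadget_phi, o2pGadget_phiAll, o2pGadget_m₁, o2pGadget_m₂, Q.N_eq]
  unfold Space.phi Space.NV Space.NnotV Space.cnt Space.wt
  rw [Finset.mul_sum, ← Finset.sum_add_distrib, ← Finset.sum_add_distrib, Finset.mul_sum,
    ← Finset.sum_add_distrib]
  apply Finset.sum_congr rfl
  intro x _
  by_cases hx : Q.V x
  · simp only [if_pos hx, if_neg (not_not.2 hx)]
    ring
  · simp only [if_neg hx, if_pos hx]
    ring

/-- **LEMMA O₂ (4), pure type `1`, the inequality**: `Ψ ≥ 0` whenever `Φ″ ≥ 0`. -/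
theorem o2_pure_nonneg (Q : Space X) (hQ : 0 ≤ Q.phi) : 0 ≤ (glue o2pGadget o2pRho₁ o2pRho₂ Q).phi := by
  rw [o2_pure]
  have := Q.N_nonneg
  linarith

end CutGlue

end PercRepro
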